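/-
COR-CM (cell pub-hodgecm2, stage 2 of the Hodge ladder) — count-neutral kernel combinatorics (seat prover-pub-hodgecm2-b23-g40-0, binder
prover b23, gen 40; claim COMPLEMENT-FACES F5, HOME/INBOX.md l.9766; the assembly of `Census/ComplementFacesWeight` (I), `…Squares` (II),
`…Weil` (III), `…Closing` (IV)).  Theorems only, in seat b09's intrinsic model (`CMF G c`, `rt`, `gface`/`gfaceSet`, `pair`/`pairSet`,
`translates`, `hodgeSpan`, `Block`, `fibreTwo`, `wdelta`, `cplT`: `Census/BlockParity*.lean`, `Census/Coinvariant*.lean` — consumed BY NAME,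
nothing restated); no definition, no certificate, no `decide`, no named fact, no geometry, no `sorry`.  `Interfaces.lean` (C1), every
E term, B01 and `Transposition/*` are untouched.
HONEST FRAMING: `HC_CM` is NOT proved, here or anywhere in the tree; nothing here is a period or a headline.
-/
import Summits.HodgeConjecture.CorCM.Census.ComplementFacesClosing

/-!
# Faces of a complemented Galois CM type, V: `β − 1 − δ` face orbits generate the Hodge lattice modulo pairs — for EVERY complement

MAIN THEOREM (**`exists_gfaces_generate_of_cpl`**, exact count **`exists_gfaces_generate_of_cpl_card_eq`**, **`isLeast_card_gfaces_generate_of_cpl`**).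
Let `G` be a finite group, `c ∈ G` a CENTRAL involution and `A ≤ G` a COMPLEMENT of `c` (`x ∈ A ↔ c·x ∉ A`, i.e. `G = A × ⟨c⟩`; `A` is ANY
finite group — no commutativity is used anywhere).  Then there is a finite set `S ⊆ gfaceSet G c` of rank-four face relations with
  `|S| + 1 + δ(G, c) = β(G, c) = #Block c`  and  `hodgeSpan c ≤ ℤ⟨pairs⟩ + ℤ⟨all base changes of S⟩`,
where `δ = wdelta` is seat b09's weight-parity invariant (`= [|A| even]` here: `Coinvariant.wdelta_eq_one_of_cpl` / part X): the integer
Hodge vectors of the Galois CM type `(G, c)` are generated, MODULO PAIRS AND INTEGRALLY (index `1`), by the `G`-translates of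
`β − 1 − δ` face relations.  By seat b09's coinvariant floor (`Coinvariant.fibreTwo_le_card_of_faces`,
`Coinvariant.fibreTwo_add_one_add_wdelta_eq_card_block_of_cpl`) NO family of fewer faces generates:
  **`μ(G, c) = φ₂(G, c) = β(G, c) − 1 − δ(G, c)`  for every complemented central involution**
(`|A|` odd: `β − 1`, one closing face beyond the canonical squares; `|A|` even: `β − 2`, the canonical squares alone).  This settles the
existence half of the face-count law on the whole complemented column — the abelian rows (seat b09 gen 26 / this seat gens 36–37–39,
`Census/OddSliceFaces*`, `Census/EvenSliceFaces*`, `CorCM/FaceAbelian*`) and the NON-ABELIAN rows censused by seat b09 gen 31 / lit-andre-3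
(`S₃ × ℤ/2: β = 10, μ = 8`; `D₄ × ℤ/2: 27, 25`; `Q₈ × ℤ/2: 21, 19`; every complemented group of order `≤ 32`) alike, census-free.
The field form (Galois CM fields containing an imaginary quadratic field; `hgen` face sets of size `β(F) − 1 − δ(F)`, least possible; the
HC socket) is `CorCM/FaceComplementGeneration.lean`.  All [folklore] bookkeeping over [Pohlmann1968, Thm 1] in the reading of
[Milne1999, Prop. 2.1].

## References
* [Pohlmann1968] H. Pohlmann, Algebraic cycles on abelian varieties of complex multiplication type, Ann. of Math. 88 (1968), Thm 1.
* [Milne1999] J. S. Milne, Lefschetz motives and the Tate conjecture, Compositio Math. 117 (1999), Prop. 2.1, p. 54.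
* [Weil1977HodgeRing] A. Weil, Abelian varieties and the Hodge ring, Œuvres Scientifiques III, [1977c], 421–429.
-/

namespace Summit.HodgeConjecture.CorCM.Census.ComplementFaces

open Finset
open scoped symmDiff
open Summit.HodgeConjecture.CorCM.Prior.AllgGroup.RfwfAllgGroup
open Summit.HodgeConjecture.CorCM.Census.BlockParity
open Summit.HodgeConjecture.CorCM.Census.Coinvariant

noncomputable section

variable {G : Type*} [Group G] [Fintype G] [DecidableEq G] (c : G)
variable {A : Subgroup G} (hA : ∀ x : G, x ∈ A ↔ c * x ∉ A)

include hA

/-! ## §1 Generation from the Weil vector -/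

/-- **If a family `S` containing the canonical squares puts the Weil vector into `ℤ⟨pairs⟩ ⊔ ℤ⟨base changes of S⟩`, then that module is
all of `hodgeSpan`** (part III). [folklore] -/
theorem hodgeSpan_le_rel_of_weil_mem (hc2 : c * c = 1) (hcen : ∀ x : G, x * c = c * x) {S : Finset (CMF G c →₀ ℤ)}
    (hS : squaresLE c hA hc2 hcen ((cplT c A hA).1.card / 2) ⊆ S)
    (hweil : weil c hc2 (cplT c A hA) ∈ Submodule.span ℤ (pairSet c) ⊔ Submodule.span ℤ (translates c S)) :
    hodgeSpan c hc2 ≤ Submodule.span ℤ (pairSet c) ⊔ Submodule.span ℤ (translates c S) := by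
  intro z hz
  obtain ⟨k, hk⟩ := exists_sub_smul_weil_mem c hA hc2 hcen _ hz fun Ψ _ => lvl_le_card c _ Ψ
  have e : z = (z - k • weil c hc2 (cplT c A hA)) + k • weil c hc2 (cplT c A hA) := by abel
  rw [e]
  exact Submodule.add_mem _ (rel_mono c hS hk) (Submodule.smul_mem _ _ hweil)

/-! ## §2 The main theorem, by parity of `|A|` -/

/-- **MAIN THEOREM, `|A|` odd**: there is `S ⊆ gfaceSet G c` with `|S| + 1 ≤ β(G, c)` whose base changes generate `hodgeSpan c` modulo
pairs (the canonical squares and ONE closing face; nothing for `|A| = 1`). [folklore] -/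
theorem exists_gfaces_generate_of_cpl_odd (hc2 : c * c = 1) (hcen : ∀ x : G, x * c = c * x) (hodd : Odd (Fintype.card G / 2)) :
    ∃ S : Finset (CMF G c →₀ ℤ), (↑S ⊆ gfaceSet G c hc2) ∧ S.card + 1 ≤ Fintype.card (Block c) ∧
      hodgeSpan c hc2 ≤ Submodule.span ℤ (pairSet c) ⊔ Submodule.span ℤ (translates c S) := by
  have hn : (cplT c A hA).1.card = Fintype.card G / 2 := card_cplT c hc2 hA
  rw [← hn] at hodd
  have hne : (cplT c A hA).1.Nonempty := ⟨1, (mem_cplT c hA 1).mpr A.one_mem⟩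
  have hβ : 1 ≤ Fintype.card (Block c) := Fintype.card_pos_iff.mpr ⟨blk c (cplT c A hA)⟩
  by_cases h1 : (cplT c A hA).1.card = 1
  · -- `|A| = 1`: no face at all, `weil` is a pair
    refine ⟨squaresLE c hA hc2 hcen ((cplT c A hA).1.card / 2), squaresLE_subset_gfaceSet c hA hc2 hcen _, ?_,
      hodgeSpan_le_rel_of_weil_mem c hA hc2 hcen subset_rfl (Submodule.mem_sup_left
        (weil_mem_span_pairSet_of_card_le_two c hc2 hcen hne (by omega)))⟩
    rw [squaresLE_eq_empty c hA hc2 hcen h1, card_empty]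
    omega
  · -- `|A| ≥ 3`: the canonical squares and one closing face
    have h3 : 3 ≤ (cplT c A hA).1.card := by obtain ⟨r, hr⟩ := hodd; omega
    obtain ⟨f, hfG, hweil⟩ := exists_closing_face_of_odd c hA hc2 hcen hodd h3
    refine ⟨insert f (squaresLE c hA hc2 hcen ((cplT c A hA).1.card / 2)), ?_, ?_,
      hodgeSpan_le_rel_of_weil_mem c hA hc2 hcen (subset_insert _ _) hweil⟩
    · rw [coe_insert]
      exact Set.insert_subset hfG (squaresLE_subset_gfaceSet c hA hc2 hcen _)
    · have h := card_squaresLE_add_two_le c hA hc2 hcen (by omega) ((cplT c A hA).1.card / 2)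
      have h' := card_insert_le f (squaresLE c hA hc2 hcen ((cplT c A hA).1.card / 2))
      omega

/-- **MAIN THEOREM, `|A|` even**: there is `S ⊆ gfaceSet G c` with `|S| + 2 ≤ β(G, c)` whose base changes generate `hodgeSpan c` modulo
pairs (the canonical squares alone). [folklore] -/
theorem exists_gfaces_generate_of_cpl_even (hc2 : c * c = 1) (hcen : ∀ x : G, x * c = c * x) (heven : Even (Fintype.card G / 2)) :
    ∃ S : Finset (CMF G c →₀ ℤ), (↑S ⊆ gfaceSet G c hc2) ∧ S.card + 2 ≤ Fintype.card (Block c) ∧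
      hodgeSpan c hc2 ≤ Submodule.span ℤ (pairSet c) ⊔ Submodule.span ℤ (translates c S) := by
  have hn : (cplT c A hA).1.card = Fintype.card G / 2 := card_cplT c hc2 hA
  have hne : (cplT c A hA).1.Nonempty := ⟨1, (mem_cplT c hA 1).mpr A.one_mem⟩
  have h1 : 1 ≤ (cplT c A hA).1.card := card_pos.mpr hne
  have h2 : 2 ≤ (cplT c A hA).1.card := by obtain ⟨r, hr⟩ := heven; omega
  refine ⟨squaresLE c hA hc2 hcen ((cplT c A hA).1.card / 2), squaresLE_subset_gfaceSet c hA hc2 hcen _,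
    card_squaresLE_add_two_le c hA hc2 hcen h2 _, hodgeSpan_le_rel_of_weil_mem c hA hc2 hcen subset_rfl ?_⟩
  by_cases h4 : 4 ≤ (cplT c A hA).1.card
  · exact weil_mem_rel_of_even c hA hc2 hcen heven h4
  · exact Submodule.mem_sup_left (weil_mem_span_pairSet_of_card_le_two c hc2 hcen hne (by obtain ⟨r, hr⟩ := heven; omega))

/-! ## §3 The exact counts (with seat b09's coinvariant floor) -/

/-- **`|A|` odd, EXACT: `|S| + 1 = β` and `|S| = φ₂`** — no family of fewer faces generates (`Coinvariant.fibreTwo_le_card_of_faces`,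
`Coinvariant.fibreTwo_add_one_eq_card_block_of_odd_half`). [folklore] -/
theorem exists_gfaces_generate_of_cpl_odd_card_eq (hc2 : c * c = 1) (hc1 : c ≠ 1) (hcen : ∀ x : G, x * c = c * x)
    (hodd : Odd (Fintype.card G / 2)) :
    ∃ S : Finset (CMF G c →₀ ℤ), (↑S ⊆ gfaceSet G c hc2) ∧ S.card + 1 = Fintype.card (Block c) ∧ fibreTwo c hc2 = S.card ∧
      hodgeSpan c hc2 ≤ Submodule.span ℤ (pairSet c) ⊔ Submodule.span ℤ (translates c S) := by
  obtain ⟨S, hS, hcard, hgen⟩ := exists_gfaces_generate_of_cpl_odd c hA hc2 hcen hodd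
  have hfloor := fibreTwo_le_card_of_faces c hc2 hcen S hS fun y hy => hgen (gfaceSet_subset_hodgeSpan c hc2 hy)
  have hβ := fibreTwo_add_one_eq_card_block_of_odd_half c hc2 hc1 hcen hodd
  exact ⟨S, hS, by omega, by omega, hgen⟩

/-- **`|A|` even, EXACT: `|S| + 2 = β` and `|S| = φ₂`** (`Coinvariant.fibreTwo_add_two_eq_card_block_of_cpl`). [folklore] -/
theorem exists_gfaces_generate_of_cpl_even_card_eq (hc2 : c * c = 1) (hc1 : c ≠ 1) (hcen : ∀ x : G, x * c = c * x)
    (heven : Even (Fintype.card G / 2)) :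
    ∃ S : Finset (CMF G c →₀ ℤ), (↑S ⊆ gfaceSet G c hc2) ∧ S.card + 2 = Fintype.card (Block c) ∧ fibreTwo c hc2 = S.card ∧
      hodgeSpan c hc2 ≤ Submodule.span ℤ (pairSet c) ⊔ Submodule.span ℤ (translates c S) := by
  obtain ⟨S, hS, hcard, hgen⟩ := exists_gfaces_generate_of_cpl_even c hA hc2 hcen heven
  have hfloor := fibreTwo_le_card_of_faces c hc2 hcen S hS fun y hy => hgen (gfaceSet_subset_hodgeSpan c hc2 hy)
  have hβ := fibreTwo_add_two_eq_card_block_of_cpl c hc2 hc1 hcen hA heven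
  exact ⟨S, hS, by omega, by omega, hgen⟩

/-! ## §4 The parity-free statement: `μ(G, c) = φ₂(G, c) = β(G, c) − 1 − δ(G, c)` -/

/-- **MAIN THEOREM (complemented central involution, any finite complement `A`).**  There is `S ⊆ gfaceSet G c` with
`|S| + 1 + δ = β(G, c)` (`δ = wdelta c T₀` at any base type) and `|S| = φ₂(G, c)`, whose base changes generate `hodgeSpan c` modulo pairs.
[folklore] -/
theorem exists_gfaces_generate_of_cpl_card_eq (hc2 : c * c = 1) (hc1 : c ≠ 1) (hcen : ∀ x : G, x * c = c * x) (T₀ : CMF G c) :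
    ∃ S : Finset (CMF G c →₀ ℤ), (↑S ⊆ gfaceSet G c hc2) ∧ S.card + 1 + wdelta c T₀ = Fintype.card (Block c) ∧
      fibreTwo c hc2 = S.card ∧ hodgeSpan c hc2 ≤ Submodule.span ℤ (pairSet c) ⊔ Submodule.span ℤ (translates c S) := by
  have hδ := fibreTwo_add_one_add_wdelta_eq_card_block_of_cpl c hc2 hc1 hcen hA T₀
  rcases Nat.even_or_odd (Fintype.card G / 2) with he | ho
  · obtain ⟨S, hS, -, hfib, hgen⟩ := exists_gfaces_generate_of_cpl_even_card_eq c hA hc2 hc1 hcen he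
    exact ⟨S, hS, by omega, hfib, hgen⟩
  · obtain ⟨S, hS, -, hfib, hgen⟩ := exists_gfaces_generate_of_cpl_odd_card_eq c hA hc2 hc1 hcen ho
    exact ⟨S, hS, by omega, hfib, hgen⟩

/-- **MAIN THEOREM, generation form** (`|S| + 1 + δ ≤ β`, no `c ≠ 1` needed beyond what the complement forces). [folklore] -/
theorem exists_gfaces_generate_of_cpl (hc2 : c * c = 1) (hc1 : c ≠ 1) (hcen : ∀ x : G, x * c = c * x) (T₀ : CMF G c) :
    ∃ S : Finset (CMF G c →₀ ℤ), (↑S ⊆ gfaceSet G c hc2) ∧ S.card + 1 + wdelta c T₀ ≤ Fintype.card (Block c) ∧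
      hodgeSpan c hc2 ≤ Submodule.span ℤ (pairSet c) ⊔ Submodule.span ℤ (translates c S) := by
  obtain ⟨S, hS, hcard, -, hgen⟩ := exists_gfaces_generate_of_cpl_card_eq c hA hc2 hc1 hcen T₀
  exact ⟨S, hS, hcard.le, hgen⟩

/-- **The face form** (the hypothesis shape of seat b09's floors): the face relations themselves lie in
`ℤ⟨pairs⟩ + ℤ⟨base changes of S⟩`, `|S| + 1 + δ = β`. [folklore] -/
theorem exists_gfaceSet_subset_of_cpl (hc2 : c * c = 1) (hc1 : c ≠ 1) (hcen : ∀ x : G, x * c = c * x) (T₀ : CMF G c) :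
    ∃ S : Finset (CMF G c →₀ ℤ), (↑S ⊆ gfaceSet G c hc2) ∧ S.card + 1 + wdelta c T₀ = Fintype.card (Block c) ∧
      gfaceSet G c hc2 ⊆ ↑(Submodule.span ℤ (pairSet c) ⊔ Submodule.span ℤ (translates c S)) := by
  obtain ⟨S, hS, hcard, -, hgen⟩ := exists_gfaces_generate_of_cpl_card_eq c hA hc2 hc1 hcen T₀
  exact ⟨S, hS, hcard, fun y hy => hgen (gfaceSet_subset_hodgeSpan c hc2 hy)⟩

/-- **`μ(G, c) = β(G, c) − 1 − δ(G, c)` EXACTLY**: the least number of face relations whose base changes generate `hodgeSpan c` modulo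
pairs, over all complemented central involutions (any finite complement). [folklore] -/
theorem isLeast_card_gfaces_generate_of_cpl (hc2 : c * c = 1) (hc1 : c ≠ 1) (hcen : ∀ x : G, x * c = c * x) (T₀ : CMF G c) :
    IsLeast {m : ℕ | ∃ S : Finset (CMF G c →₀ ℤ), (↑S ⊆ gfaceSet G c hc2) ∧ S.card = m ∧
      hodgeSpan c hc2 ≤ Submodule.span ℤ (pairSet c) ⊔ Submodule.span ℤ (translates c S)}
      (Fintype.card (Block c) - 1 - wdelta c T₀) := by
  have hδ := fibreTwo_add_one_add_wdelta_eq_card_block_of_cpl c hc2 hc1 hcen hA T₀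
  constructor
  · obtain ⟨S, hS, hcard, -, hgen⟩ := exists_gfaces_generate_of_cpl_card_eq c hA hc2 hc1 hcen T₀
    exact ⟨S, hS, by omega, hgen⟩
  · rintro m ⟨S, hS, rfl, hgen⟩
    have hfloor := fibreTwo_le_card_of_faces c hc2 hcen S hS fun y hy => hgen (gfaceSet_subset_hodgeSpan c hc2 hy)
    omega

/-- **`μ(G, c) = φ₂(G, c)`**: the coinvariant floor is attained by faces, for every complemented central involution. [folklore] -/
theorem isLeast_card_gfaces_generate_fibreTwo_of_cpl (hc2 : c * c = 1) (hc1 : c ≠ 1) (hcen : ∀ x : G, x * c = c * x) :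
    IsLeast {m : ℕ | ∃ S : Finset (CMF G c →₀ ℤ), (↑S ⊆ gfaceSet G c hc2) ∧ S.card = m ∧
      hodgeSpan c hc2 ≤ Submodule.span ℤ (pairSet c) ⊔ Submodule.span ℤ (translates c S)} (fibreTwo c hc2) := by
  have h := isLeast_card_gfaces_generate_of_cpl c hA hc2 hc1 hcen (cplT c A hA)
  have hδ := fibreTwo_add_one_add_wdelta_eq_card_block_of_cpl c hc2 hc1 hcen hA (cplT c A hA)
  rwa [show Fintype.card (Block c) - 1 - wdelta c (cplT c A hA) = fibreTwo c hc2 by omega] at h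

/-! ## §5 By index: a subgroup of index two missing `c` -/

omit hA in
/-- **Index-two form**: for a central involution `c` and a subgroup `A` of index `2` with `c ∉ A`, `β − 1 − δ` face relations generate
`hodgeSpan c` modulo pairs, and no fewer do. [folklore] -/
theorem isLeast_card_gfaces_generate_of_index_two (hc2 : c * c = 1) (hc1 : c ≠ 1) (hcen : ∀ x : G, x * c = c * x)
    (h2 : A.index = 2) (hc : c ∉ A) (T₀ : CMF G c) :
    IsLeast {m : ℕ | ∃ S : Finset (CMF G c →₀ ℤ), (↑S ⊆ gfaceSet G c hc2) ∧ S.card = m ∧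
      hodgeSpan c hc2 ≤ Submodule.span ℤ (pairSet c) ⊔ Submodule.span ℤ (translates c S)}
      (Fintype.card (Block c) - 1 - wdelta c T₀) :=
  isLeast_card_gfaces_generate_of_cpl c (cpl_of_index_two c h2 hc) hc2 hc1 hcen T₀

end

end Summit.HodgeConjecture.CorCM.Census.ComplementFaces
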